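import Summits.HodgeConjecture.CorCM.HypLiu418.OffPlaceTowerIso
import Summits.HodgeConjecture.CorCM.B01.Transposition.HComp.HeckeTranslatesOfSec42DataOf
import Literature.AlgebraicGeometry.HodgeTheory.ComplexPointsLifting
import HarnessLib

/-!
# The off-place tower isomorphism intertwines the Hecke translates; the induced isomorphisms of the Albanese towers

Cell `hodgecm-mathlib`, fan A — `hLiu418` OFF PLACE (crux `stmt-HodgeConjecture-24832`, registered residual `stub_bettiThetaModel_offPlace`
of `Cruxes/HLiu418/Lines/a3_liu418.lean` v4), END plan v1 piece **D1** (lead A-p02 after A-p08; FILE A = ✔ `OffPlaceTowerIso`).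

For `V : HermSpace3 F ι₁` (`6 ≤ [F:ℚ]`) write `τ̄ := conj ∘ ι₁`, `V₀ := V.alongConj` (the SAME Gram matrix read at `τ̄`, FILE A),
`R := recordOf h V h4`, `R₀ := recordOf h V₀ h4` (the two CHOSEN canonical-model record systems), and `φ : R.M ≅ R₀.M` the isomorphism of
model towers of ✔ `recordOf_iso_recordOf_alongConj_of_unique` (modulo row I-4 `canonicalModel_unique_printed`), which comes WITH its action
on complex points.

* §1 (record level, generic) `iso_hom_comm_of_isHeckeTranslate`: an isomorphism `φ : R.M ≅ R₀.M` between a record system along `ι₁` and one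
  along `τ̄` (same `H`, same `K₀`) satisfying FILE A's points clause INTERTWINES every pair of Hecke translates `T_g` (on `R`, pinned by
  points along `ι₁`) and `T_g` (on `R₀`, pinned along `τ̄`): `φ_K ≫ T_g = T_g ≫ φ_{K'}` — by ✔ `RecordSystem.heckeTranslate_unique` (morphisms
  of the models are determined by their complex points), the clause, and naturality of the twist `P ↦ Spec(conj) ≫ P` (✔ `twist_comp`).
* §2 (the (U7) translates of the two chosen systems) `recordHeckeTranslate_comm_offPlaceIso`.
* §3 (the explicit §4.2 data `ℭ₁' := sec42DataOfFourLe h V Φ h4 _`, `ℭ₀' := sec42DataOfFourLe h V₀ Φ' h4 _`; `X_K = M_K ⊗_{F,c} F`):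
  `exists_albIso_albTr_comm` — isomorphisms of the Albanese varieties `α_K : Alb X_K ≅ Alb X₀_K` over `F`, for all small `K`, commuting with
  the Hecke homomorphisms `Alb(T_g)` of the two data (`Albanese.map` functoriality on `ψ_K := (φ_K) ⊗_c F`).  This is the input `(α, hα)` of
  D2 `Sec42Data.BettiPinning.nonempty_transport` (identifications `eG`, `eK`, `eh` the identities: same `U(V)(𝔸_f)`, same `K_f(3)`).

KERNEL: theorems only; conditional on the named facts `h : exists_recordSystem` (row I-2), `hU7 : heckeTranslate_definedOver` (row I-3) and
`hU : canonicalModel_unique_printed` (row I-4) taken as HYPOTHESES; no `sorry`.  HC_CM is NOT proved here; HC_CM is proved only modulo the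
7 printed citations until rung 0 closes.

References: [Milne2005ShimuraVarieties] Thm. 13.6 p. 118, Thm. 13.7 (a) p. 119, Prop. 13.1 p. 117; [Liu2021] §4.2 l. 2062–2074, Def. 2.3;
[Deligne1979ShimuraVarieties] 2.2.5.
-/

set_option autoImplicit false

noncomputable section

open CategoryTheory AlgebraicGeometry NumberField IsDedekindDomain Matrix
open Literature.AlgebraicGeometry.Motives
open Literature.NumberTheory.Automorphic.Liu2021.AppendixC (C5.OpenCompactSubgroup C5.SmallLevel C5.HeckeLE)

namespace Summit.HodgeConjecture.CorCM.Model.RecordSystemConj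

open scoped Matrix
open Literature.AlgebraicGeometry.ShimuraVarieties Literature.AlgebraicGeometry.ShimuraVarieties.UnitaryCanonicalModel
open Literature.NumberTheory.Automorphic Literature.NumberTheory.Automorphic.UnitaryGroup
open Literature.NumberTheory.Automorphic.ShimuraDissection
open Literature.Geometry.ComplexHyperbolic Literature.Geometry.ComplexHyperbolic.BallModel
open Summit.HodgeConjecture.CorCM.D2Bridge (twist twist_comp conjEmb conjEmb_eq PointsAlong)

/-! ## §1 An isomorphism of model towers with FILE A's points clause intertwines Hecke translates (generic record level) -/

section Record

variable {L : Type} [Field L] [NumberField L] [IsCMField L] {H : Matrix (Fin 3) (Fin 3) L} {τ : L →+* ℂ}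
  {T : GL (Fin 3) ℂ} {hT : formCongr (starRingEnd ℂ) T (H.map τ) = BallModel.J}
  {T₀ : GL (Fin 3) ℂ} {hT₀ : formCongr (starRingEnd ℂ) T₀ (H.map ((starRingEnd ℂ).comp τ)) = BallModel.J}
  {K₀ : C5.OpenCompactSubgroup ↥(finAdelic (↥(maximalRealSubfield L)) L (IsCMField.complexConj L) 3 H)}

set_option maxHeartbeats 400000 in
-- the points of the models carry two `Algebra L ℂ` structures (`τ`, `conj ∘ τ`); unfolding `IsHeckeTranslate` against them is slow
/-- **An isomorphism of model towers carrying points to points intertwines the Hecke translates.**  Let `R` be a record system of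
`(H, τ, T)` and `R₀` one of `(H, τ̄, T₀)` (`τ̄ = conj ∘ τ`, same threshold `K₀`), and `φ : R.M ≅ R₀.M` an isomorphism of the model towers whose
complex points along `τ̄` satisfy FILE A's clause `φ_K (Spec(conj) ≫ R.pts_K⁻¹ [\overline{u • y}, aK]) = R₀.pts_K⁻¹ [y, aK]` (`u = (conj T)⁻¹ T₀`).
If `f : M_K ⟶ M_{K'}` acts as `[z, aK] ↦ [z, agK']` on `R`'s points and `f₀ : M₀_K ⟶ M₀_{K'}` does so on `R₀`'s points, then
`φ_K ≫ f₀ = f ≫ φ_{K'}` — both `φ_K⁻¹ ≫ f ≫ φ_{K'}` and `f₀` are Hecke translates for `R₀`, which are unique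
([Milne2005ShimuraVarieties] Prop. 13.1: morphisms of the models are determined by complex points).
[cite: Milne2005ShimuraVarieties, Thm. 13.6 p. 118 L21–28 and Prop. 13.1 p. 117] -/
theorem iso_hom_comm_of_isHeckeTranslate (R : RecordSystem L H τ T hT K₀)
    (R₀ : RecordSystem L H ((starRingEnd ℂ).comp τ) T₀ hT₀ K₀) (φ : R.M ≅ R₀.M)
    (hφ : letI : Algebra L ℂ := ((starRingEnd ℂ).comp τ).toAlgebra
      ∀ (K : C5.SmallLevel K₀) (y : Ball) (a : finAdelic (↥(maximalRealSubfield L)) L (IsCMField.complexConj L) 3 H),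
        (AlgPoints.baseChangeEquiv ((starRingEnd ℂ).comp τ) (R₀.M.obj K)).symm
            (AlgPoints.map ((baseChangeHom ((starRingEnd ℂ).comp τ)).map (φ.hom.app K))
              (AlgPoints.baseChangeEquiv ((starRingEnd ℂ).comp τ) (R.M.obj K)
                (twist (conjEmb_eq τ) (letI : Algebra L ℂ := τ.toAlgebra
                  (R.pts K).symm (ShimuraSet.mk L H τ T hT K.1.1
                    (conjBall (frameRatio L H ((starRingEnd ℂ).comp τ) (conjFrame T) T₀
                      (formCongr_conjFrame_starRingEnd_comp H τ T hT) hT₀ • y)) a))))) =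
          (R₀.pts K).symm (ShimuraSet.mk L H ((starRingEnd ℂ).comp τ) T₀ hT₀ K.1.1 y a))
    {g : finAdelic (↥(maximalRealSubfield L)) L (IsCMField.complexConj L) 3 H} {K K' : C5.SmallLevel K₀}
    {f : R.M.obj K ⟶ R.M.obj K'} (hf : R.IsHeckeTranslate K K' g f)
    {f₀ : R₀.M.obj K ⟶ R₀.M.obj K'} (hf₀ : R₀.IsHeckeTranslate K K' g f₀) :
    φ.hom.app K ≫ f₀ = f ≫ φ.hom.app K' := by
  letI : Algebra L ℂ := ((starRingEnd ℂ).comp τ).toAlgebra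
  -- the clause, read through `M(ℂ) ≃ M_{τ̄}(ℂ)` (`baseChangeEquiv_symm_map`): `φ_K • Q_K(y,a) = R₀.pts_K⁻¹ [y,a]` for the twisted points
  -- `Q_K(y,a) := Spec(conj) ≫ R.pts_K⁻¹ [\overline{u • y}, aK]` of `M_K` along `τ̄`
  have hφ' : ∀ (K : C5.SmallLevel K₀) (y : Ball) (a : finAdelic (↥(maximalRealSubfield L)) L (IsCMField.complexConj L) 3 H),
      AlgPoints.map (φ.hom.app K)
          (twist (conjEmb_eq τ) (letI : Algebra L ℂ := τ.toAlgebra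
            (R.pts K).symm (ShimuraSet.mk L H τ T hT K.1.1
              (conjBall (frameRatio L H ((starRingEnd ℂ).comp τ) (conjFrame T) T₀
                (formCongr_conjFrame_starRingEnd_comp H τ T hT) hT₀ • y)) a))) =
        (R₀.pts K).symm (ShimuraSet.mk L H ((starRingEnd ℂ).comp τ) T₀ hT₀ K.1.1 y a) := by
    intro K y a
    have h1 := hφ K y a
    rw [Literature.AlgebraicGeometry.HodgeTheory.baseChangeEquiv_symm_map, Equiv.symm_apply_apply] at h1
    exact h1
  -- `f` carries `Q_K(y,a)` to `Q_{K'}(y,ag)`: naturality of the twist and the Hecke property of `f` along `τ`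
  have hfQ : ∀ (y : Ball) (a : finAdelic (↥(maximalRealSubfield L)) L (IsCMField.complexConj L) 3 H),
      AlgPoints.map f
          (twist (conjEmb_eq τ) (letI : Algebra L ℂ := τ.toAlgebra
            (R.pts K).symm (ShimuraSet.mk L H τ T hT K.1.1
              (conjBall (frameRatio L H ((starRingEnd ℂ).comp τ) (conjFrame T) T₀
                (formCongr_conjFrame_starRingEnd_comp H τ T hT) hT₀ • y)) a))) =
        twist (conjEmb_eq τ) (letI : Algebra L ℂ := τ.toAlgebra
          (R.pts K').symm (ShimuraSet.mk L H τ T hT K'.1.1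
            (conjBall (frameRatio L H ((starRingEnd ℂ).comp τ) (conjFrame T) T₀
              (formCongr_conjFrame_starRingEnd_comp H τ T hT) hT₀ • y)) (a * g))) := by
    intro y a
    rw [AlgPoints.map_apply, ← twist_comp]
    congr 1
    letI : Algebra L ℂ := τ.toAlgebra
    have h2 := hf (conjBall (frameRatio L H ((starRingEnd ℂ).comp τ) (conjFrame T) T₀
      (formCongr_conjFrame_starRingEnd_comp H τ T hT) hT₀ • y)) a
    rw [← h2, Homeomorph.symm_apply_apply, AlgPoints.map_apply]
  -- hence `φ_K⁻¹ ≫ f ≫ φ_{K'}` is a Hecke translate for `R₀`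
  have key : R₀.IsHeckeTranslate K K' g (φ.inv.app K ≫ f ≫ φ.hom.app K') := by
    unfold RecordSystem.IsHeckeTranslate
    intro z a
    have e1 : AlgPoints.map (φ.inv.app K ≫ f ≫ φ.hom.app K')
          ((R₀.pts K).symm (ShimuraSet.mk L H ((starRingEnd ℂ).comp τ) T₀ hT₀ K.1.1 z a)) =
        (R₀.pts K').symm (ShimuraSet.mk L H ((starRingEnd ℂ).comp τ) T₀ hT₀ K'.1.1 z (a * g)) := by
      rw [← hφ' K z a, ← hφ' K' z (a * g), ← hfQ]
      simp only [AlgPoints.map_apply, Category.assoc, Iso.hom_inv_id_app_assoc]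
    rw [e1, Homeomorph.apply_symm_apply]
  rw [← R₀.heckeTranslate_unique key hf₀, Iso.hom_inv_id_app_assoc]

end Record

/-! ## §2 The two CHOSEN systems of the faces `(ι₁, V)` and `(τ̄, V.alongConj)` and their (U7) Hecke translates -/

section Chosen

variable {F : CMField} {ι₁ : F →+* ℂ}

open Summit.HodgeConjecture.CorCM.HComp

/-- **The off-place tower isomorphism intertwines the chosen Hecke translates.**  For `φ : (recordOf h V h4).M ≅ (recordOf h V.alongConj h4).M`
with FILE A's points clause (✔ `recordOf_iso_recordOf_alongConj_of_unique`), and the (U7) translates `T_g` CHOSEN on the two systems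
(✔ `recordHeckeTranslate`, pinned by complex points along `ι₁`, resp. `τ̄ = conj ∘ ι₁`): `φ_K ≫ T_g = T_g ≫ φ_{K'}`.
[cite: Milne2005ShimuraVarieties, Thm. 13.6 p. 118 L21–28 and Prop. 13.1 p. 117] -/
theorem offPlaceIso_hom_comm_recordHeckeTranslate (hU7 : heckeTranslate_definedOver) (h : exists_recordSystem)
    (V : HermSpace3 F ι₁) (h4 : 4 ≤ Module.finrank ℚ F) (φ : (recordOf h V h4).M ≅ (recordOf h V.alongConj h4).M)
    (hφ : letI : Algebra (F : Type) ℂ := ((starRingEnd ℂ).comp ι₁).toAlgebra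
      ∀ (K : C5.SmallLevel (K3 V)) (y : Ball) (a : V.adelicFin),
        (AlgPoints.baseChangeEquiv ((starRingEnd ℂ).comp ι₁) ((recordOf h V.alongConj h4).M.obj K)).symm
            (AlgPoints.map ((baseChangeHom ((starRingEnd ℂ).comp ι₁)).map (φ.hom.app K))
              (AlgPoints.baseChangeEquiv ((starRingEnd ℂ).comp ι₁) ((recordOf h V h4).M.obj K)
                (twist (conjEmb_eq ι₁) (letI : Algebra (F : Type) ℂ := ι₁.toAlgebra
                  ((recordOf h V h4).pts K).symm (ShimuraSet.mk F V.Hm ι₁ (frameOf V) (formCongr_frameOf V) K.1.1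
                    (conjBall (frameRatio F V.Hm ((starRingEnd ℂ).comp ι₁) (conjFrame (frameOf V)) (frameOf V.alongConj)
                      (formCongr_conjFrame_starRingEnd_comp V.Hm ι₁ (frameOf V) (formCongr_frameOf V)) (formCongr_frameOf V.alongConj) • y))
                    a))))) =
          ((recordOf h V.alongConj h4).pts K).symm
            (ShimuraSet.mk F V.Hm ((starRingEnd ℂ).comp ι₁) (frameOf V.alongConj) (formCongr_frameOf V.alongConj) K.1.1 y a))
    (g : V.adelicFin) (K K' : C5.SmallLevel (K3 V)) (hK : C5.HeckeLE g K K') :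
    φ.hom.app K ≫ recordHeckeTranslate hU7 h V.alongConj h4 g K K' hK =
      recordHeckeTranslate hU7 h V h4 g K K' hK ≫ φ.hom.app K' :=
  iso_hom_comm_of_isHeckeTranslate (recordOf h V h4) (recordOf h V.alongConj h4) φ hφ
    (isHeckeTranslate_recordHeckeTranslate hU7 h V h4 g K K' hK)
    (isHeckeTranslate_recordHeckeTranslate hU7 h V.alongConj h4 g K K' hK)

/-- The same on the TOTAL record functors `recordFunctorOf` (through ✔ `recordFunctorOf_objIso`): the levelwise isomorphisms
`φ'_K := objIso_K ≫ φ_K ≫ objIso₀_K⁻¹ : (recordFunctorOf h V) K ≅ (recordFunctorOf h V.alongConj) K` intertwine ✔ `recordFunctorHeckeTranslate`.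
[cite: Milne2005ShimuraVarieties, Thm. 13.6 p. 118] [cite: Deligne1979ShimuraVarieties, 2.2.5] -/
theorem offPlaceIso_hom_comm_recordFunctorHeckeTranslate (hU7 : heckeTranslate_definedOver) (h : exists_recordSystem)
    (V : HermSpace3 F ι₁) (h4 : 4 ≤ Module.finrank ℚ F) (φ : (recordOf h V h4).M ≅ (recordOf h V.alongConj h4).M)
    (hcomm : ∀ (g : V.adelicFin) (K K' : C5.SmallLevel (K3 V)) (hK : C5.HeckeLE g K K'),
      φ.hom.app K ≫ recordHeckeTranslate hU7 h V.alongConj h4 g K K' hK = recordHeckeTranslate hU7 h V h4 g K K' hK ≫ φ.hom.app K')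
    (g : V.adelicFin) (K K' : C5.SmallLevel (K3 V)) (hK : C5.HeckeLE g K K') :
    (recordFunctorOf_objIso h V h4 K ≪≫ φ.app K ≪≫ (recordFunctorOf_objIso h V.alongConj h4 K).symm).hom ≫
        recordFunctorHeckeTranslate hU7 h V.alongConj h4 g K K' hK =
      recordFunctorHeckeTranslate hU7 h V h4 g K K' hK ≫
        (recordFunctorOf_objIso h V h4 K' ≪≫ φ.app K' ≪≫ (recordFunctorOf_objIso h V.alongConj h4 K').symm).hom := by
  simp only [Iso.trans_hom, Iso.app_hom, Iso.symm_hom, recordFunctorHeckeTranslate, Category.assoc, Iso.inv_hom_id_assoc]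
  rw [reassoc_of% (hcomm g K K' hK)]

end Chosen

/-! ## §3 The explicit §4.2 data of the two faces: tower isomorphisms `X_K ≅ X₀_K` and Albanese isomorphisms commuting with `Alb(T_g)` -/

section Sec42

variable {F : CMField} {ι₁ : F →+* ℂ}

open Summit.HodgeConjecture.CorCM.HComp
open Literature.NumberTheory.Automorphic.Liu2021 Literature.NumberTheory.Automorphic.Liu2021.AppendixC

/-- **D1.**  For the EXPLICIT §4.2 data `ℭ₁' := sec42DataOfFourLe h V Φ h4 iso₁` and `ℭ₀' := sec42DataOfFourLe h V.alongConj Φ' h4 iso₀` of the two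
faces (ANY `Φ`, `Φ'`, `iso₁`, `iso₀`: the towers `X_K = M_K ⊗_{F,c} F` and their CHOSEN Albanese data do not read them; same group
`U(V)(𝔸_{F⁺,f})`, same threshold `K_f(3)`), modulo rows I-3/I-4 there are isomorphisms of abelian varieties over `F`
`α_K : Alb X_K ≅ Alb X₀_K` (`K ≤ K_f(3)`) commuting with the Hecke homomorphisms `Alb(T_g)` of the two data:
`Alb(T_g) ≫ α_{K'} = α_K ≫ Alb(T₀_g)` — `α_K := Alb(ψ_K)`, `ψ_K := φ'_K ⊗_c F` (§2), by functoriality of `Alb` (✔ `Albanese.map_comp/map_id`).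
This is the input `(α, hα)` of D2 `Sec42Data.BettiPinning.nonempty_transport` (with `eG`, `eK`, `eh` the identities).
[cite: Liu2021, §4.2 l. 2062–2074 and Def. 2.3 l. 1206–1208] [cite: Milne2005ShimuraVarieties, Thm. 13.6 p. 118 and Thm. 13.7 (a) p. 119] -/
theorem exists_albIso_albTr_comm (hU7 : heckeTranslate_definedOver) (hU : canonicalModel_unique_printed) (h : exists_recordSystem)
    (V : HermSpace3 F ι₁) (Φ Φ' : CMType F) (h4 : 4 ≤ Module.finrank ℚ F) (iso₁ iso₀ : ℕ → Prop) :
    ∃ α : ∀ K : C5.SmallLevel (K3 V), (sec42DataOfFourLe h V Φ h4 iso₁).A K ≅ (sec42DataOfFourLe h V.alongConj Φ' h4 iso₀).A K,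
      ∀ (g : V.adelicFin) (K K' : C5.SmallLevel (K3 V)) (hK : C5.HeckeLE g K K'),
        (sec42DataOfFourLe_heckeTranslates hU7 h V Φ h4 iso₁).albTr g K K' hK ≫ (α K').hom =
          (α K).hom ≫ (sec42DataOfFourLe_heckeTranslates hU7 h V.alongConj Φ' h4 iso₀).albTr g K K' hK := by
  obtain ⟨φ, hφ⟩ := recordOf_iso_recordOf_alongConj_of_unique hU h V h4
  have hcomm := offPlaceIso_hom_comm_recordHeckeTranslate hU7 h V h4 φ hφ
  -- the levelwise isomorphisms of the total record functors and of the towers `X_K = M_K ⊗_c F`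
  let φ' : ∀ K : C5.SmallLevel (K3 V), (recordFunctorOf h V).obj K ≅ (recordFunctorOf h V.alongConj).obj K := fun K =>
    recordFunctorOf_objIso h V h4 K ≪≫ φ.app K ≪≫ (recordFunctorOf_objIso h V.alongConj h4 K).symm
  let ψ : ∀ K : C5.SmallLevel (K3 V), (sec42DataOfFourLe h V Φ h4 iso₁).X K ≅ (sec42DataOfFourLe h V.alongConj Φ' h4 iso₀).X K :=
    fun K => (baseChangeHom (cmConjRingHom F)).mapIso (φ' K)
  have hψ : ∀ (g : V.adelicFin) (K K' : C5.SmallLevel (K3 V)) (hK : C5.HeckeLE g K K'),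
      (ψ K).hom ≫ (sec42DataOfFourLe_heckeTranslates hU7 h V.alongConj Φ' h4 iso₀).tr g K K' hK =
        (sec42DataOfFourLe_heckeTranslates hU7 h V Φ h4 iso₁).tr g K K' hK ≫ (ψ K').hom := by
    intro g K K' hK
    change (baseChangeHom (cmConjRingHom F)).map (φ' K).hom ≫
        (baseChangeHom (cmConjRingHom F)).map (recordFunctorHeckeTranslate hU7 h V.alongConj h4 g K K' hK) =
      (baseChangeHom (cmConjRingHom F)).map (recordFunctorHeckeTranslate hU7 h V h4 g K K' hK) ≫
        (baseChangeHom (cmConjRingHom F)).map (φ' K').hom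
    rw [← Functor.map_comp, ← Functor.map_comp, offPlaceIso_hom_comm_recordFunctorHeckeTranslate hU7 h V h4 φ hcomm]
  refine ⟨fun K =>
    { hom := ((sec42DataOfFourLe h V Φ h4 iso₁).alb K).map ((sec42DataOfFourLe h V.alongConj Φ' h4 iso₀).alb K) (ψ K).hom
      inv := ((sec42DataOfFourLe h V.alongConj Φ' h4 iso₀).alb K).map ((sec42DataOfFourLe h V Φ h4 iso₁).alb K) (ψ K).inv
      hom_inv_id := by rw [← Albanese.map_comp, Iso.hom_inv_id, Albanese.map_id]
      inv_hom_id := by rw [← Albanese.map_comp, Iso.inv_hom_id, Albanese.map_id] }, fun g K K' hK => ?_⟩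
  change ((sec42DataOfFourLe h V Φ h4 iso₁).alb K).map ((sec42DataOfFourLe h V Φ h4 iso₁).alb K') _ ≫
      ((sec42DataOfFourLe h V Φ h4 iso₁).alb K').map ((sec42DataOfFourLe h V.alongConj Φ' h4 iso₀).alb K') (ψ K').hom =
    ((sec42DataOfFourLe h V Φ h4 iso₁).alb K).map ((sec42DataOfFourLe h V.alongConj Φ' h4 iso₀).alb K) (ψ K).hom ≫
      ((sec42DataOfFourLe h V.alongConj Φ' h4 iso₀).alb K).map ((sec42DataOfFourLe h V.alongConj Φ' h4 iso₀).alb K') _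
  rw [← Albanese.map_comp, ← Albanese.map_comp, hψ]

end Sec42

end Summit.HodgeConjecture.CorCM.Model.RecordSystemConj

end
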